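import Summits.ABC.IUTFork.LDHGenuinePerImageSufficiencyNum
import Literature.IUT.LogVolume.Corollary22Thm110LegendreWitness
import Literature.IUT.LogVolume.Corollary22PartIIUpTo
import Literature.IUT.LogVolume.Corollary22LegendreDeepAdmissiblePairs
import HarnessLib

/-!
# The fork at [IUTchIII] Corollary 3.12, L-DH level, READING (P): the (P)-line crux is a KERNEL THEOREM at every point with
# rational `j`-invariant and LOCAL HEIGHTS `≤ 5` — and at the explicit Legendre point `λ = 11/14` (= `λ₁` of the cell's HEX family)
# for EVERY prime `l ≥ 5` (abc-iut cell, crux ThetaPartII = stmt-ABC-19678, stub `stub_cor312PerImage`)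

Record-only PROOF file (D-0012) of the abc-iut cell (WAVE-3 discharge seat abc-iut-c312-d1, gen 7; row «P-CRUX-SUFFICIENCY», part H —
the NUM-side certificate pattern proposed for R-W's WINDOW-TABLE column «szpiro_margin»). TAKES NO SIDE on [IUTchIII] Cor. 3.12.
Parts B/G (p446147/p449008) prove the per-image / number-level Corollary at every datum of a Szpiro-good `(P, l)`. HERE the Szpiro-good
hypothesis is discharged from LOCAL HEIGHTS alone:

* `Cor22.logQAvoid_le_mul_logCondAvoid` — if every local height `h_v ≤ H` then `log q^{∤S}(λ) ≤ H·log 𝔣^{∤S}(λ)` (`𝔮 = Σ h_v[v]`, `𝔣 = Σ [v]`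
  over the same bad places; [IUTchIV] p. 23);
* **`Cor22.cor312PerImageAtDatum_of_localHeight_le`** — `λ ∈ U_X`, `d_mod = 1`, `l ≥ 5`, every local height `≤ H` with
  `H ≤ 6(l−1)(l+1)/((l+4)(l−3))` ⟹ `Cor22.Cor312PerImageAtDatum P l`; **`…_of_localHeight_le_five`** — `H = 5` works for EVERY `l ≥ 5`
  (`6(l²−1) ≥ 5(l+4)(l−3)` always): every point with rational `j` all of whose local heights (orders of the `q`-parameters = pole orders of
  `j(λ)`) are `≤ 5` satisfies the (P)-line crux — and the (U)-line crux — at EVERY genuine Θ-datum, for every `l ≥ 5`;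
* **`Cor22.cor312PerImageAtDatum_ratPoint_eleven_fourteenths`** — the explicit point `λ = 11/14 ∈ ℚ` (`λ₁ = 1/2 + 2/7` of the HEX family
  `Cor22.exists_ratPoint_mem_std_two`): `j(11/14) = 2⁶·163³/(3·7·11)²`, so every local height is `≤ 2` (`ord_v(231) ≤ 1` at every place of
  `ℚ`), hence **`Cor22.Cor312PerImageAtDatum (ratPoint (11/14)) l` and `Cor22.Cor312AtDatum (ratPoint (11/14)) l` for every `l ≥ 5`**.

HONEST SCOPE. `Cor312PerImageAtDatum P l` quantifies over the genuine Θ-volume data at `(P, l)`; it is contentful exactly when such data exist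
(= the admissibility conditions of [IUTchI] Def. 3.1 at `(P, l)`, e.g. `SL₂ ⊆` Galois image — NOT certified here for `λ = 11/14`; abstractly
inhabited at admissible points by abc-iut-L5-t7's `ThetaPartII.stub_thetaData`). So the last item says: WHATEVER Θ-data exist at `(11/14, l)`,
the disputed inequality holds there as typed (per image and for the union). Nothing here asserts the existence of data, Cor. 3.12 in general, or
abc; proved-as-typed ≠ in print. [cite: Mochizuki2012, IUTchIII Cor. 3.12 p. 173–174; IUTchIV Thm. 1.10 p. 22–23, Cor. 2.2 (ii) proof p. 44–46]
[cite: MochizukiGenEll2010, Def. 3.3 p. 12] [claim: Mochizuki2012, status: disputed] for every IUT quotation. PROOF-ONLY: no definitions.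
-/

noncomputable section

namespace Literature.IUT.LogVolume.Cor22

open NumberField IsDedekindDomain Literature.NumberTheory.DiophantineGeometry
open Literature.NumberTheory.DiophantineGeometry.GenEll Summit.ABC.IUTFork

/-! ## 1. `log q^{∤S} ≤ H · log 𝔣^{∤S}` when every local height is `≤ H` -/

/-- **`log q^{∤S}(λ) ≤ H·log 𝔣^{∤S}(λ)`** if every local height of `λ` at a bad place is `≤ H` (`𝔮` and `𝔣` are supported on the same
bad places away from `S`, with coefficients `h_v` resp. `1`). [cite: Mochizuki2012, IUTchIV Thm. 1.10 p. 23] -/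
theorem logQAvoid_le_mul_logCondAvoid (P : NFPoint) (S : Finset ℕ) {H : ℝ}
    (hH : ∀ v ∈ badPlaces P, localHeight P v ≤ H) : logQAvoid P S ≤ H * logCondAvoid P S := by
  classical
  unfold logQAvoid logCondAvoid qDivisor condDivisor
  rw [map_sum, map_sum, Finset.mul_sum]
  refine Finset.sum_le_sum fun v hv => ?_
  have hvb : v ∈ badPlaces P := (Finset.mem_filter.1 hv).1
  rw [FinDivisor.ndeg_of, FinDivisor.ndeg_of, one_mul]
  have hln : 0 ≤ logNorm P.F v / (Module.finrank ℚ P.F : ℝ) :=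
    div_nonneg (logNorm_pos P.F v).le FinDivisor.finrank_pos.le
  have := mul_le_mul_of_nonneg_right (hH v hvb) hln
  calc localHeight P v * logNorm P.F v / (Module.finrank ℚ P.F : ℝ)
        = localHeight P v * (logNorm P.F v / (Module.finrank ℚ P.F : ℝ)) := by ring
    _ ≤ H * (logNorm P.F v / (Module.finrank ℚ P.F : ℝ)) := this

/-! ## 2. The (P)-line crux from a local-height bound -/

variable {P : NFPoint} {l : ℕ}

/-- **The (P)-line crux from bounded local heights**: `λ ∈ U_X`, `d_mod = 1`, `l ≥ 5`; if every local height is `≤ H` with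
`H ≤ 6(l−1)(l+1)/((l+4)(l−3))`, then `Cor22.Cor312PerImageAtDatum P l` (part B's `cor312PerImageAtDatum_of_szpiroSix` with
`log q ≤ H·log 𝔣 ≤ (6l(l+1)/((l+4)(l−3)))·(1 − 1/l)·log 𝔣`, `log-diff ≥ 0`, `log π ≥ 0`). [cite: Mochizuki2012, IUTchIII Cor. 3.12 p. 173–174]
[claim: Mochizuki2012, status: disputed] -/
theorem cor312PerImageAtDatum_of_localHeight_le (hU : P.InU) (h5 : 5 ≤ l) (hd : dmod P = 1) {H : ℝ}
    (hH : ∀ v ∈ badPlaces P, localHeight P v ≤ H)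
    (hHl : H ≤ 6 * ((l : ℝ) - 1) * ((l : ℝ) + 1) / (((l : ℝ) + 4) * ((l : ℝ) - 3))) :
    Cor312PerImageAtDatum P l := by
  have hl5 : (5 : ℝ) ≤ l := by exact_mod_cast h5
  have hl0 : (0 : ℝ) < l := by linarith
  have hden : 0 < ((l : ℝ) + 4) * ((l : ℝ) - 3) := by nlinarith
  refine cor312PerImageAtDatum_of_szpiroSix hU h5 hd ?_
  have hq := logQAvoid_le_mul_logCondAvoid P {2, l} hH
  have hC0 : 0 ≤ logCondAvoid P {2, l} := logCondAvoid_nonneg P _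
  have hD0 : 0 ≤ P.logDiff := P.logDiff_nonneg
  have hpi0 : 0 ≤ Real.log Real.pi := Real.log_nonneg (by linarith [Real.pi_gt_three])
  have hc1 : 0 ≤ 6 * l * ((l : ℝ) + 1) / (((l : ℝ) + 4) * ((l : ℝ) - 3)) := by positivity
  have hc2 : 0 ≤ 6 * l * ((l : ℝ) + 5) / (((l : ℝ) + 4) * ((l : ℝ) - 3)) := by positivity
  -- `(6l(l+1)/((l+4)(l−3)))·(1 − 1/l) = 6(l−1)(l+1)/((l+4)(l−3))`
  have hkey : 6 * l * ((l : ℝ) + 1) / (((l : ℝ) + 4) * ((l : ℝ) - 3)) * (1 - 1 / (l : ℝ)) =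
      6 * ((l : ℝ) - 1) * ((l : ℝ) + 1) / (((l : ℝ) + 4) * ((l : ℝ) - 3)) := by
    field_simp
  have h1 : H * logCondAvoid P {2, l} ≤
      6 * l * ((l : ℝ) + 1) / (((l : ℝ) + 4) * ((l : ℝ) - 3)) * ((1 - 1 / (l : ℝ)) * logCondAvoid P {2, l}) := by
    rw [← mul_assoc, hkey]
    exact mul_le_mul_of_nonneg_right hHl hC0
  have h2 : 0 ≤ 6 * l * ((l : ℝ) + 1) / (((l : ℝ) + 4) * ((l : ℝ) - 3)) * P.logDiff := mul_nonneg hc1 hD0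
  have h3 : 0 ≤ 6 * l * ((l : ℝ) + 5) / (((l : ℝ) + 4) * ((l : ℝ) - 3)) * Real.log Real.pi := mul_nonneg hc2 hpi0
  nlinarith [hq, h1, h2, h3]

/-- **LOCAL HEIGHTS `≤ 5` SUFFICE AT EVERY `l ≥ 5`**: `λ ∈ U_X`, `d_mod = 1`, every local height `≤ 5` ⟹ `Cor22.Cor312PerImageAtDatum P l`
for every `l ≥ 5` (`6(l²−1) ≥ 5(l+4)(l−3)`). [cite: Mochizuki2012, IUTchIII Cor. 3.12 p. 173–174] [claim: Mochizuki2012, status: disputed] -/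
theorem cor312PerImageAtDatum_of_localHeight_le_five (hU : P.InU) (h5 : 5 ≤ l) (hd : dmod P = 1)
    (hH : ∀ v ∈ badPlaces P, localHeight P v ≤ 5) : Cor312PerImageAtDatum P l := by
  have hl5 : (5 : ℝ) ≤ l := by exact_mod_cast h5
  have hden : 0 < ((l : ℝ) + 4) * ((l : ℝ) - 3) := by nlinarith
  refine cor312PerImageAtDatum_of_localHeight_le hU h5 hd hH ?_
  rw [le_div_iff₀ hden]
  nlinarith

/-- The same in reading (U): local heights `≤ 5` ⟹ `Cor22.Cor312AtDatum P l` for every `l ≥ 5`. [claim: Mochizuki2012, status: disputed]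
[cite: Mochizuki2012, IUTchIII Cor. 3.12 p. 173–174] -/
theorem cor312AtDatum_of_localHeight_le_five (hU : P.InU) (h5 : 5 ≤ l) (hd : dmod P = 1)
    (hH : ∀ v ∈ badPlaces P, localHeight P v ≤ 5) : Cor312AtDatum P l :=
  cor312AtDatum_of_perImage (cor312PerImageAtDatum_of_localHeight_le_five hU h5 hd hH)

/-! ## 3. The explicit point `λ = 11/14` -/

section Explicit

open Rat.HeightOneSpectrum UniformABCConjecture

/-- `ord_v(n) = 0` for a natural number prime to `p_v`. [folklore] -/
private theorem ord_natCast_eq_zero_of_not_dvd (v : HeightOneSpectrum (𝓞 ℚ)) {n : ℕ}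
    (h : ¬ natGenerator v ∣ n) : ord ℚ v (n : ℚ) = 0 := by
  unfold ord
  rw [(valuation_natCast_eq_one_iff v n).2 h, WithZero.log_one, neg_zero]

/-- Natural numbers have `ord_v ≥ 0`. [folklore] -/
private theorem ord_natCast_nonneg (v : HeightOneSpectrum (𝓞 ℚ)) (n : ℕ) : 0 ≤ ord ℚ v (n : ℚ) := by
  simpa using ord_nonneg_of_isIntegral ℚ v (n : 𝓞 ℚ)

/-- `ord_v(q) ≤ 1` for a prime `q` at every finite place of `ℚ`, with equality only over `q`. [folklore] -/
private theorem ord_prime_le_one (v : HeightOneSpectrum (𝓞 ℚ)) {q : ℕ} (hq : q.Prime) : ord ℚ v (q : ℚ) ≤ 1 := by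
  by_cases h : natGenerator v ∣ q
  · have heq : natGenerator v = q := (Nat.prime_dvd_prime_iff_eq (prime_natGenerator v) hq).1 h
    rw [← heq, ord_natGenerator_eq_one]
  · rw [ord_natCast_eq_zero_of_not_dvd v h]; norm_num

/-- `ord_v(231) ≤ 1` at every finite place of `ℚ` (`231 = 3·7·11` is squarefree). [folklore] -/
private theorem ord_231_le_one (v : HeightOneSpectrum (𝓞 ℚ)) : ord ℚ v (231 : ℚ) ≤ 1 := by
  have hp := prime_natGenerator v
  by_cases h3 : natGenerator v = 3
  · have e : (231 : ℚ) = (3 : ℕ) * ((77 : ℕ) : ℚ) := by norm_num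
    have hnd : ¬ natGenerator v ∣ 77 := by rw [h3]; norm_num
    rw [e, ord_mul ℚ v (by norm_num) (by norm_num), ord_natCast_eq_zero_of_not_dvd v hnd, add_zero]
    exact ord_prime_le_one v (by norm_num)
  by_cases h7 : natGenerator v = 7
  · have e : (231 : ℚ) = (7 : ℕ) * ((33 : ℕ) : ℚ) := by norm_num
    have hnd : ¬ natGenerator v ∣ 33 := by rw [h7]; norm_num
    rw [e, ord_mul ℚ v (by norm_num) (by norm_num), ord_natCast_eq_zero_of_not_dvd v hnd, add_zero]
    exact ord_prime_le_one v (by norm_num)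
  by_cases h11 : natGenerator v = 11
  · have e : (231 : ℚ) = (11 : ℕ) * ((21 : ℕ) : ℚ) := by norm_num
    have hnd : ¬ natGenerator v ∣ 21 := by rw [h11]; norm_num
    rw [e, ord_mul ℚ v (by norm_num) (by norm_num), ord_natCast_eq_zero_of_not_dvd v hnd, add_zero]
    exact ord_prime_le_one v (by norm_num)
  · have hnd : ¬ natGenerator v ∣ 231 := by
      intro h
      have h' : natGenerator v ∣ 3 * 7 * 11 := by norm_num at h ⊢; exact h
      rcases (Nat.Prime.dvd_mul hp).1 h' with h'' | h''
      · rcases (Nat.Prime.dvd_mul hp).1 h'' with h''' | h'''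
        · exact h3 ((Nat.prime_dvd_prime_iff_eq hp (by norm_num)).1 h''')
        · exact h7 ((Nat.prime_dvd_prime_iff_eq hp (by norm_num)).1 h''')
      · exact h11 ((Nat.prime_dvd_prime_iff_eq hp (by norm_num)).1 h'')
    have e : (231 : ℚ) = ((231 : ℕ) : ℚ) := by norm_num
    rw [e, ord_natCast_eq_zero_of_not_dvd v hnd]; norm_num

/-- `j(11/14) = 277167808/231²` (`= 2⁶·163³/(3·7·11)²`). [folklore] -/
private theorem jInv_eleven_fourteenths : jInv ((11 : ℚ) / 14) = (277167808 : ℚ) / 231 ^ 2 := by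
  norm_num [jInv]

/-- Every local height of `λ = 11/14` is `≤ 2`: `ord_v(j(11/14)) ≥ −2` at every finite place of `ℚ`. [folklore] -/
private theorem neg_two_le_ord_jInv_eleven_fourteenths (v : HeightOneSpectrum (𝓞 ℚ)) :
    -2 ≤ ord ℚ v (jInv ((11 : ℚ) / 14)) := by
  rw [jInv_eleven_fourteenths, div_eq_mul_inv, ord_mul ℚ v (by norm_num) (by norm_num), ord_inv, ord_pow]
  have h1 : 0 ≤ ord ℚ v (277167808 : ℚ) := by
    have h := ord_natCast_nonneg v 277167808
    simp only [Nat.cast_ofNat] at h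
    exact h
  have h2 : ((2 : ℕ) : ℤ) * ord ℚ v (231 : ℚ) ≤ 2 := by
    have := ord_231_le_one v
    push_cast
    linarith
  linarith

/-- `localHeight (ratPoint (11/14)) v ≤ 2` at every place. [folklore] -/
private theorem localHeight_ratPoint_eleven_fourteenths_le (v : HeightOneSpectrum (𝓞 ℚ)) :
    localHeight (ratPoint ((11 : ℚ) / 14)) v ≤ 2 := by
  have h := neg_two_le_ord_jInv_eleven_fourteenths v
  have : (-(ord ℚ v (jInv ((11 : ℚ) / 14)))).toNat ≤ 2 := by
    rw [Int.toNat_le]; push_cast; linarith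
  have h' : (((-(ord ℚ v (jInv ((11 : ℚ) / 14)))).toNat : ℕ) : ℝ) ≤ 2 := by exact_mod_cast this
  exact h'

/-- **THE (P)-LINE CRUX AT `λ = 11/14` FOR EVERY `l ≥ 5`**: `Cor22.Cor312PerImageAtDatum (ratPoint (11/14)) l` — [IUTchIII] Cor. 3.12 in
reading (P) holds, as typed, at EVERY genuine Θ-volume datum of the Legendre point `λ = 11/14` (`= λ₁` of the HEX family) and every prime
level `l ≥ 5` (`j = 2⁶·163³/231²`: all local heights `≤ 2`, `d_mod = 1`). Contentful exactly when Θ-data exist at `(11/14, l)` (admissibility,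
not certified here). [cite: Mochizuki2012, IUTchIII Cor. 3.12 p. 173–174] [claim: Mochizuki2012, status: disputed] -/
theorem cor312PerImageAtDatum_ratPoint_eleven_fourteenths (h5 : 5 ≤ l) :
    Cor312PerImageAtDatum (ratPoint ((11 : ℚ) / 14)) l := by
  have hUP := ratPoint_mem_UPle_one (q := (11 : ℚ) / 14) (by norm_num) (by norm_num)
  refine cor312PerImageAtDatum_of_localHeight_le hUP.1.1 h5
    (dmod_eq_one_of_degree_le_one (le_of_eq (degree_ratPoint _)))
    (fun v _ => localHeight_ratPoint_eleven_fourteenths_le v) ?_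
  have hl5 : (5 : ℝ) ≤ l := by exact_mod_cast h5
  have hden : 0 < ((l : ℝ) + 4) * ((l : ℝ) - 3) := by nlinarith
  rw [le_div_iff₀ hden]
  nlinarith

/-- … and in reading (U): `Cor22.Cor312AtDatum (ratPoint (11/14)) l` for every `l ≥ 5`. [claim: Mochizuki2012, status: disputed]
[cite: Mochizuki2012, IUTchIII Cor. 3.12 p. 173–174] -/
theorem cor312AtDatum_ratPoint_eleven_fourteenths (h5 : 5 ≤ l) : Cor312AtDatum (ratPoint ((11 : ℚ) / 14)) l :=
  cor312AtDatum_of_perImage (cor312PerImageAtDatum_ratPoint_eleven_fourteenths h5)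

end Explicit

end Literature.IUT.LogVolume.Cor22

end
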